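import Mathlib
import HarnessLib

/-!
# Route `DiophantineDichotomy`, crux `KhovanskiiApproxTypeEv` (stmt-Schanuel-14972), line `lambert-liouville-kill`:
# stub `stub_liouvilleWindow` — Liouville scales inside a window

Crux `Summit.Schanuel.Schanuel.Theses.DiophantineDichotomy.KhovanskiiApproxTypeEv` (item stmt-Schanuel-14972),
certificate line `lambert-liouville-kill` (skeleton `Cruxes/KhovanskiiApproxTypeEv/Lines/lambert_liouville_kill.lean`,
lead `prover-line-stmt-Schanuel-14972-a1-0`), registered stub `stub_liouvilleWindow` (landed `--supports stmt-Schanuel-14972`).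

A positive Liouville number `x` with `k x < 1` has, for every exponent `m` and every threshold `N`, a
rational `p/q` (`p q : ℕ`) with `q ≥ N`, `p ≥ 1`, `k p ≤ q`, `x/2 ≤ p/q` and `|x − p/q| ≤ q^{−m}`.  In the
certificates `notLiouville_lambert_of_ev` / `notLiouville_lambert_of_evAnchored` these are the Liouville
scales `q` of the Lambert number `x = W(1/k)` at which the challenger `(1, p/q, α, q/(kp))` is built
(`k p ≤ q`, `p ≥ 1` make `q/(kp)` a legitimate approximation of `eˣ = 1/(kx)`; `x/2 ≤ p/q` controls its
error).  Proof: Mathlib's `Liouville.frequently_exists_num (m+1)` gives `a/b` with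
`|x − a/b| < b^{−(m+1)} ≤ 1/b` frequently in `b : ℕ`; intersect (`Filter.Frequently.and_eventually`) with
the eventual conditions `b ≥ N`, `b ≥ 1`, `1/b < δ := min (x/2) ((1 − k x)/(k+1))`
(`tendsto_one_div_atTop_nhds_zero_nat`).  Then `a/b ≥ x − δ ≥ x/2 > 0` forces `a ≥ 1`, and
`k · a/b < k x + k δ ≤ k x + (1 − k x) = 1` forces `k a < b`.  Pure Mathlib; no tree inputs.
-/

noncomputable section

-- `Summit.Schanuel.Schanuel.…` is the mandated summit/sub-problem namespace (single-conjunct summit), hence: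
set_option linter.dupNamespace false

namespace Summit.Schanuel.Schanuel.Cruxes.KhovanskiiApproxTypeEv.LambertLiouvilleKill

open Polynomial Filter Topology

/-- Window bookkeeping for one approximation: if `k x < 1`, `0 < b`, and an integer `a` satisfies
`x − δ < a/b < x + δ` with `δ ≤ x/2` and `δ ≤ (1 − k x)/(k + 1)`, then `a = p` for a natural number
`p ≥ 1` with `k p ≤ b` and `x/2 ≤ p/b`.  (The window forces `δ > 0`, so `a/b > x − δ ≥ δ > 0` gives
`a ≥ 1`; `k a/b < k x + k δ ≤ 1` gives `k a < b`.) [folklore] -/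
lemma window_of_approx (x δ : ℝ) (k b : ℕ) (a : ℤ) (hkx : (k : ℝ) * x < 1) (hb0 : 0 < b)
    (hδx : δ ≤ x / 2) (hδk : δ ≤ (1 - k * x) / (k + 1))
    (hlo : x - δ < (a : ℝ) / b) (hhi : (a : ℝ) / b < x + δ) :
    ∃ p : ℕ, (p : ℤ) = a ∧ 1 ≤ p ∧ k * p ≤ b ∧ x / 2 ≤ (p : ℝ) / b := by
  have hk0 : (0 : ℝ) ≤ k := Nat.cast_nonneg k
  have hb0' : (0 : ℝ) < b := by exact_mod_cast hb0
  -- lower bound: `a/b ≥ x/2 > 0`, hence `a ≥ 1`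
  have hab : x / 2 ≤ (a : ℝ) / b := by linarith
  have habpos : (0 : ℝ) < (a : ℝ) / b := by linarith
  have ha0' : (0 : ℝ) < a := by
    by_contra h
    have : (a : ℝ) / b ≤ 0 := div_nonpos_of_nonpos_of_nonneg (not_lt.mp h) hb0'.le
    linarith
  have ha0 : (0 : ℤ) < a := by exact_mod_cast ha0'
  obtain ⟨p, rfl⟩ := Int.eq_ofNat_of_zero_le ha0.le
  push_cast at hab hhi ha0'
  have hp0 : 0 < p := by exact_mod_cast ha0'
  -- upper bound: `k p / b < 1`, hence `k p ≤ b`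
  have hkε : (k : ℝ) * δ ≤ 1 - k * x := by
    have h1 : (k : ℝ) * δ ≤ k * ((1 - k * x) / (k + 1)) := mul_le_mul_of_nonneg_left hδk hk0
    have h2 : (k : ℝ) * ((1 - k * x) / (k + 1)) ≤ 1 - k * x := by
      rw [mul_div_assoc', div_le_iff₀ (by positivity)]
      nlinarith
    exact h1.trans h2
  have hkpb : (k : ℝ) * p ≤ b := by
    have h2 : (k : ℝ) * ((p : ℝ) / b) ≤ k * (x + δ) := mul_le_mul_of_nonneg_left hhi.le hk0
    have h3 : (k : ℝ) * ((p : ℝ) / b) ≤ 1 := by nlinarith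
    rwa [mul_div_assoc', div_le_one hb0'] at h3
  refine ⟨p, rfl, hp0, ?_, hab⟩
  exact_mod_cast hkpb

/-- **STUB 1 (Liouville scales inside a window).**  A positive Liouville number `x` with `k x < 1`
has, for every exponent `m` and every threshold `N`, a rational `p/q` (`p q : ℕ`) with `q ≥ N`,
`p ≥ 1`, `k p ≤ q`, `x/2 ≤ p/q` and `|x − p/q| ≤ q^{−m}`.  Proof: Mathlib's
`Liouville.frequently_exists_num (m+1)` intersected (`Filter.Frequently.and_eventually`) with the
eventual conditions `b ≥ N`, `b ≥ 1`, `1/b < min (x/2) ((1 − k x)/(k+1))`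
(`tendsto_one_div_atTop_nhds_zero_nat`); the window bookkeeping is `window_of_approx`, and
`1/q^{m+1} ≤ 1/q^m`. [folklore] -/
theorem stub_liouvilleWindow :
    ∀ (x : ℝ) (k : ℕ), Liouville x → 0 < x → (k : ℝ) * x < 1 → ∀ (m N : ℕ),
      ∃ p q : ℕ, N ≤ q ∧ 1 ≤ p ∧ k * p ≤ q ∧ x / 2 ≤ (p : ℝ) / q ∧
        |x - (p : ℝ) / q| ≤ 1 / (q : ℝ) ^ m := by
  intro x k hL hx0 hkx m N
  -- the half-width of the window
  set δ : ℝ := min (x / 2) ((1 - k * x) / (k + 1)) with hδ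
  have hδ0 : 0 < δ := lt_min (by linarith) (div_pos (by linarith) (by positivity))
  have hδx : δ ≤ x / 2 := min_le_left _ _
  have hδk : δ ≤ (1 - k * x) / (k + 1) := min_le_right _ _
  -- eventual side conditions on the denominator, met frequently by Liouville denominators
  have hev : ∀ᶠ b : ℕ in atTop, N ≤ b ∧ 1 ≤ b ∧ 1 / (b : ℝ) < δ :=
    (eventually_ge_atTop N).and ((eventually_ge_atTop 1).and
      ((tendsto_one_div_atTop_nhds_zero_nat (𝕜 := ℝ)).eventually (eventually_lt_nhds hδ0)))
  obtain ⟨b, ⟨a, -, hlt⟩, hNb, h1b, hbδ⟩ :=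
    ((hL.frequently_exists_num (m + 1)).and_eventually hev).exists
  have hb1 : (1 : ℝ) ≤ b := by exact_mod_cast h1b
  have hb0 : (0 : ℝ) < b := by linarith
  -- the approximation lies inside the window `|x - a/b| < δ`
  have hpow : 1 / (b : ℝ) ^ (m + 1) ≤ 1 / (b : ℝ) :=
    one_div_le_one_div_of_le hb0 (by
      calc (b : ℝ) = (b : ℝ) ^ 1 := (pow_one _).symm
        _ ≤ (b : ℝ) ^ (m + 1) := pow_le_pow_right₀ hb1 (by omega))
  have hwin : |x - a / b| < δ := lt_of_lt_of_le hlt (hpow.trans hbδ.le)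
  obtain ⟨hlo, hhi⟩ := abs_sub_lt_iff.1 hwin
  obtain ⟨p, hpa, hp1, hkpb, hwin'⟩ :=
    window_of_approx x δ k b a hkx (by omega) hδx hδk (by linarith) (by linarith)
  refine ⟨p, b, hNb, hp1, hkpb, hwin', ?_⟩
  -- precision: `1/b^(m+1) ≤ 1/b^m`
  have hpa' : (p : ℝ) = (a : ℝ) := by rw [← hpa]; exact (Int.cast_natCast p).symm
  rw [hpa']
  have hpow' : 1 / (b : ℝ) ^ (m + 1) ≤ 1 / (b : ℝ) ^ m :=
    one_div_le_one_div_of_le (pow_pos hb0 m) (pow_le_pow_right₀ hb1 (Nat.le_succ m))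
  exact hlt.le.trans hpow'

end Summit.Schanuel.Schanuel.Cruxes.KhovanskiiApproxTypeEv.LambertLiouvilleKill

end
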